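import Summits.FinalStateConjecture.FinalStateConjecture.Theorems.SwallowTheDatumSubdataDevelopmentsEmbedRestartLU
import Summits.FinalStateConjecture.FinalStateConjecture.Theorems.SwallowTheDatumSubdataDevelopmentsEmbedRestartSetup
import Summits.FinalStateConjecture.FinalStateConjecture.Theorems.SwallowTheDatumSubdataDevelopmentsEmbedTwoFacts
import Literature.Geometry.Lorentzian.CommonDevelopmentRestartAgreement
import HarnessLib

/-!
# Route SwallowTheDatum · item `SubdataDevelopmentsEmbed` (stmt-FinalStateConjecture-10053) —
# the restart of the local uniqueness theorem from a spacelike boundary point of a common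
# development (Sbierski 2016, §3.2, proof of Thm. 12), given local uniqueness

The item is closed by `subdataDevelopmentsEmbed_of_locallyUnique_of_sbierski`
(`…TwoFacts.lean`) from the two named facts
`hawkingEllis_locallyUnique_vacuumDevelopment` (LU) and
`sbierski_commonDevelopment_lt_of_hasCorrespondingBoundaryPoints` (T12 = Sbierski 2016, Thm. 12).
T12 in turn follows (`sbierski_commonDevelopment_lt_of_restart_jet`,
`CommonDevelopmentRestartAgreement.lean`) from RESTART DATA at a boundary point of the common
development `𝔠 = (U, ψ)` of `𝒟₁`, `𝒟₂`: an open `N' ⊆ I±(ι X)` of `M₁`, a set `S ⊆ N' ∩ Ū`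
which is a Cauchy hypersurface of `(N', g₁|_{N'})`, and a time-orientation preserving isometric
immersion `φ : N' → M₂` which at every point of `S` has the `1`-jet of some local smooth extension
of `ψ`, with `N' ⊄ U`. This file (fifth of five: `…RestartPrep`, `…RestartChart`, `…RestartLU`, `…RestartSetup`,
`…Restart`) produces exactly these data from LU and the following LOCAL
GEOMETRIC INPUT at a boundary point `p₀ ∉ U` (the output of Sbierski's Lemmas 14–16 and of the
time-separation argument of the proof of Thm. 12, pp. 15–16 of arXiv:1309.7591v3, which are
formalised separately):

* (H1) `p₀ ∈ I⁺(ι₁ X)` or `p₀ ∈ I⁻(ι₁ X)`;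
* (H2) a function `f`, `C^∞` on an open `W ∋ p₀`, with `f p₀ = 0` and differential positive on the
  future causal cone at `p₀` (Sbierski: `f = τ₀ - τ_q`, the time separation from a suitable `q`);
* (H3) the level set `{f = 0} ∩ W` lies in the closure of `U` (Sbierski: "`S ⊆ Ū ∩ J⁺(ι(M̄))`");
* (H4) a map `ψ̂`, `C^∞` on `W`, agreeing with `ψ` on `W ∩ U`, with injective differential at `p₀`
  (Sbierski's Lemma 14: the extension `ψ̂ = exp ∘ ψ_* ∘ exp⁻¹` of `ψ` across the corresponding
  boundary points, a local diffeomorphism).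

**Theorem `restart_of_locallyUnique`**: under LU, (H1)–(H4) give the restart data. The
construction is Sbierski's ("we can thus map `S` isometrically to `ψ(S) ⊆ M'` — and suitable
neighbourhoods of `S` in `M` and of `ψ(S)` in `M'` are GHDs of `(S, ḡ_S, k_S)`. By Theorem 2.4 there
exists a GHD `N ⊆ M` of `(S, ḡ_S, k_S)` together with an isometric embedding `φ : N → M'` such that
`φ|_S = ψ|_S` … we obtain `(dψ)|_S = (dφ)|_S`"), carried out in a chart `Φ` of `M₁` at `p₀` adapted
to `f` (`(Φ q)⁰ = f q`, `Literature.Geometry.Manifold.exists_mem_maximalAtlas_apply_zero_eq`) with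
ball-shaped target `T ⊆ ℝ⁴`:

1. on `T` there are two time-oriented vacuum metrics, `Ĝ = (Φ⁻¹)^* g₁` (`CoordChart.lorentzMetric`)
   and `Ĝ' = (ψ̂ ∘ Φ⁻¹)^* g₂` (`LorentzianMetric.comap`), which agree on the open set
   `Φ(U ∩ Φ.source)` (`ψ̂ = ψ` is an isometry there) and hence to first order along the slice
   `{x⁰ = 0} ⊆ Φ({f = 0}) ⊆ Φ(Ū)` (`CoordSlice.eq_and_fderiv_eq_of_eqOn`);
2. the slice is spacelike with future unit normal `-♯dx⁰/√lapseSq`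
   (`CoordChart.lapseSq_metricRepr_pos`, `OpensChart.isFutureDirected_sliceNormal_of_pos`), so a
   ball `B` of it carries ONE initial data set `D_S = (h, k)` induced by both metrics
   (`CoordSlice.exists_initialDataSet`, `CoordSlice.initialDataSet_congr`) and two data embeddings
   `𝒮̂_a = (T, Ĝ, …)`, `𝒮̂_b = (T, Ĝ', …)` of `D_S` (`CoordSlice.sliceDataEmbedding`);
3. lens-shaped neighbourhoods `V_a`, `V_b ⊆ T` of the slice piece in which it is a Cauchy
   hypersurface, for `Ĝ` and for `Ĝ'` over the SAME ball (`exists_isCauchyHypersurface_restrict_lens_opens`),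
   give two vacuum Cauchy developments `𝒟̂_a`, `𝒟̂_b` of `D_S` (`DataEmbedding.restrict`);
4. LU gives a common development `𝒰 ≼ 𝒟̂_a, 𝒟̂_b`; composing with the inclusions, the inverse
   chart `Φ⁻¹ : (T, Ĝ) → (M₁, g₁)` and `ψ̂ ∘ Φ⁻¹ : (T, Ĝ') → (M₂, g₂)` (isometric immersions by
   construction) and realising inside `M₁` (`CauchyDevelopment.exists_realised_range`) gives
   `N' = J(𝒰) ⊆ Φ.source ⊆ I±`, `S = Φ⁻¹({0} × B) ⊆ {f = 0} ⊆ Ū` Cauchy in `N'`, and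
   `φ = K ∘ J⁻¹`;
5. the `1`-jet: `φ ∘ ι_S = ψ̂ ∘ ι_S` and both differentials send the normal of `S` to the future
   unit normal of `ψ̂(S)` — `φ` being isometric and orientation preserving on `N'`
   (`DataEmbedding.mfderiv_eq_mfderiv_of_mfderiv_normal_eq_at`), `ψ̂` because the normals of
   `𝒮̂_a` and `𝒮̂_b` coincide (`CoordSlice.sliceNormalField_congr`); and `p₀ ∈ N' \\ U`.

CONDITIONAL on LU only (a hypothesis, displayed). Everything else is proved. Consumers:
`thm12_of_locallyUnique_of_boundaryData` packages the reduction
`LU ∧ (∀ 𝔠 with corresponding boundary points, ∃ p₀ W f ψ̂ with (H1)–(H4)) → T12`, and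
`subdataDevelopmentsEmbed_of_locallyUnique_of_boundaryData` the resulting form of the item.
-/

noncomputable section

open Bundle Set Function Filter TopologicalSpace Manifold Topology Metric
open scoped Manifold ContDiff Topology

namespace Summit.FinalStateConjecture.FinalStateConjecture.Theorems

namespace SubdataDevelopmentsEmbed

open Literature.Geometry.Lorentzian

/-! ### The restart -/

/-- **The restart of the local uniqueness theorem from a spacelike boundary point of a common
development** (Sbierski 2016, §3.2, proof of Thm. 12, last two paragraphs before "Also note"),
GIVEN local uniqueness (`hawkingEllis_locallyUnique_vacuumDevelopment`, Hawking–Ellis 1973, §7.5;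
Sbierski 2016, Thm. 2.4 (ii)) and the local boundary data (H1)–(H4) of the module docstring: there
are an open `N' ⊆ I±(ι₁ X)`, a set `S ⊆ N' ∩ Ū` Cauchy in `(N', g₁|_{N'})`, and a time-orientation
preserving isometric immersion `φ : N' → M₂` with the `1`-jet of the local extension `ψ̂` of `ψ`
at every point of `S`, and `N' ⊄ U` — the hypothesis `hrestart` of
`sbierski_commonDevelopment_lt_of_restart_jet` at this boundary point. See the module docstring for
the construction (chart adapted to `f`, two vacuum metrics on the chart target agreeing to first
order along the slice, common slice data, lens developments, LU, realisation in `M₁`, `1`-jet).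
[cite: Sbierski2016AHP, §3.2, proof of Thm. 12 (arXiv: pp. 15–16)]
[cite: HawkingEllis1973CUP, §7.5, pp. 248–249] -/
theorem restart_of_locallyUnique (hLU : hawkingEllis_locallyUnique_vacuumDevelopment)
    {N : Type} [TopologicalSpace N] [ChartedSpace E3 N] [IsManifold (𝓡 3) ∞ N] [ConnectedSpace N]
    {D₁ : InitialDataSet (𝓡 3) N} (𝒟₁ 𝒟₂ : VacuumCauchyDevelopment D₁)
    (𝔠 : CauchyDevelopment.CommonDevelopment 𝒟₁.toCauchyDevelopment 𝒟₂.toCauchyDevelopment)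
    {p₀ : 𝒟₁.carrier} (hp₀U : p₀ ∉ 𝔠.opens)
    (hp₀I : p₀ ∈ 𝒟₁.metric.chronologicalFuture 𝒟₁.timeOrientation (range 𝒟₁.embed) ∨
      p₀ ∈ 𝒟₁.metric.chronologicalPast 𝒟₁.timeOrientation (range 𝒟₁.embed))
    {W : Set 𝒟₁.carrier} (hW : IsOpen W) (hp₀W : p₀ ∈ W)
    {f : 𝒟₁.carrier → ℝ} (hf : ContMDiffOn (𝓡 4) 𝓘(ℝ, ℝ) ∞ f W) (hfp₀ : f p₀ = 0)
    (hdf : ∀ v : TangentSpace (𝓡 4) p₀, 𝒟₁.timeOrientation.IsFutureDirected v →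
      (0 : ℝ) < mfderiv (𝓡 4) 𝓘(ℝ, ℝ) f p₀ v)
    (hlevel : ∀ q ∈ W, f q = 0 → q ∈ closure (𝔠.opens : Set 𝒟₁.carrier))
    {ψ : 𝒟₁.carrier → 𝒟₂.carrier} (hψs : ContMDiffOn (𝓡 4) (𝓡 4) ∞ ψ W)
    (hψU : ∀ (q : 𝒟₁.carrier) (hq : q ∈ 𝔠.opens), q ∈ W → ψ q = 𝔠.map ⟨q, hq⟩)
    (hdψ : Injective (mfderiv (𝓡 4) (𝓡 4) ψ p₀)) :
    ∃ (N' : Opens 𝒟₁.carrier) (S : Set 𝒟₁.carrier) (φ : N' → 𝒟₂.carrier) (hSN : S ⊆ N'),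
      ((N' : Set 𝒟₁.carrier) ⊆
          𝒟₁.metric.chronologicalFuture 𝒟₁.timeOrientation (range 𝒟₁.embed) ∨
        (N' : Set 𝒟₁.carrier) ⊆
          𝒟₁.metric.chronologicalPast 𝒟₁.timeOrientation (range 𝒟₁.embed)) ∧
      S ⊆ closure (𝔠.opens : Set 𝒟₁.carrier) ∧
      (𝒟₁.metric.restrict PseudoRiemannianMetric.contMDiff_restrict_holds N').IsCauchyHypersurface
        (𝒟₁.timeOrientation.restrict PseudoRiemannianMetric.contMDiff_restrict_holds
          𝒟₁.timeOrientation.contMDiff_restrict_holds N') (Subtype.val ⁻¹' S) ∧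
      (𝒟₁.metric.restrict PseudoRiemannianMetric.contMDiff_restrict_holds N').IsIsometricImmersion
        𝒟₂.metric.toPseudoRiemannianMetric φ ∧
      (𝒟₁.timeOrientation.restrict PseudoRiemannianMetric.contMDiff_restrict_holds
        𝒟₁.timeOrientation.contMDiff_restrict_holds N').PreservesTimeOrientation φ
          𝒟₂.timeOrientation ∧
      (∀ (s : 𝒟₁.carrier) (hs : s ∈ S), ∃ (W' : Set 𝒟₁.carrier) (ψ' : 𝒟₁.carrier → 𝒟₂.carrier),
        IsOpen W' ∧ s ∈ W' ∧ ContMDiffOn (𝓡 4) (𝓡 4) ∞ ψ' W' ∧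
        (∀ (q : 𝒟₁.carrier) (hq : q ∈ 𝔠.opens), q ∈ W' → ψ' q = 𝔠.map ⟨q, hq⟩) ∧
        ψ' s = φ ⟨s, hSN hs⟩ ∧
        mfderiv (𝓡 4) (𝓡 4) ψ' s = mfderiv (𝓡 4) (𝓡 4) φ ⟨s, hSN hs⟩) ∧
      ¬ ((N' : Set 𝒟₁.carrier) ⊆ 𝔠.opens) := by
  obtain ⟨B, hBconn, D, 𝒮a, 𝒮b, Va, hιa, Vb, hιb, χa, χb, e, hva, hvb, hconn_a, hCa, hconn_b, hCb,
      hχao, hχai, hχaτ, hχbo, hχbi, hχbτ, he, hed, heν, hψe, hχaW, hχaI, hfzero, y₀, hp₀⟩ :=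
    exists_sliceDevelopments_of_boundaryData 𝒟₁ 𝒟₂ 𝔠 hp₀I hW hp₀W hf hfp₀ hdf hlevel hψs hψU hdψ
  haveI : ConnectedSpace B := hBconn
  have hψd : ∀ y : B, MDifferentiableAt (𝓡 4) (𝓡 4) ψ (χa (𝒮a.embed y)) := fun y ↦
    ((hψs _ (hχaW ⟨_, rfl⟩)).contMDiffAt (hW.mem_nhds (hχaW ⟨_, rfl⟩))).mdifferentiableAt (by simp)
  obtain ⟨N', φ', hN'sub, hι₁N', hC', hφs, hφiso, hφτ, hjet⟩ :=
    exists_restart_of_sliceDevelopments hLU 𝒮a 𝒮b hva hvb Va hconn_a hιa hCa Vb hconn_b hιb hCb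
      𝒟₁.toSpacetime 𝒟₂.toSpacetime hχao hχai hχaτ hχbo hχbi hχbτ he hed heν hψe hψd
  set ι₁ : B → 𝒟₁.carrier := χa ∘ 𝒮a.embed with hι₁_def
  have hSN : range ι₁ ⊆ N' := by rintro _ ⟨y, rfl⟩; exact hι₁N' y
  refine ⟨N', range ι₁, fun q ↦ φ' q.1, hSN, ?_, ?_, hC', ?_, ?_, ?_, ?_⟩
  · -- `N' ⊆ I±(ι X)`
    rcases hχaI with h | h
    · exact Or.inl (hN'sub.trans h)
    · exact Or.inr (hN'sub.trans h)
  · -- `S ⊆ Ū`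
    rintro _ ⟨y, rfl⟩
    exact hlevel _ (hχaW ⟨_, rfl⟩) (hfzero y)
  · -- isometric immersion on the subtype
    have hd : ∀ q : N', MDifferentiableAt (𝓡 4) (𝓡 4) φ' q.1 := fun q ↦
      ((hφs q.1 q.2).contMDiffAt (N'.isOpen.mem_nhds q.2)).mdifferentiableAt (by simp)
    refine ⟨hφs.comp_contMDiff contMDiff_subtype_val fun q ↦ q.2, fun q ↦ ?_⟩
    have hmf : mfderiv (𝓡 4) (𝓡 4) (fun q : N' ↦ φ' q.1) q = mfderiv (𝓡 4) (𝓡 4) φ' q.1 :=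
      mfderiv_comp_subtypeVal (hd q)
    ext v w
    have hk := congrArg (fun b ↦ b v w) (hφiso q.1 q.2)
    simp only [pullbackBilin_apply] at hk ⊢
    rw [hmf]
    exact hk
  · -- time orientation on the subtype
    intro q
    have hd : MDifferentiableAt (𝓡 4) (𝓡 4) φ' q.1 :=
      ((hφs q.1 q.2).contMDiffAt (N'.isOpen.mem_nhds q.2)).mdifferentiableAt (by simp)
    have hmf : mfderiv (𝓡 4) (𝓡 4) (fun q : N' ↦ φ' q.1) q = mfderiv (𝓡 4) (𝓡 4) φ' q.1 :=
      mfderiv_comp_subtypeVal hd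
    show 𝒟₂.timeOrientation.IsFutureDirected
      (mfderiv (𝓡 4) (𝓡 4) (fun q : N' ↦ φ' q.1) q (𝒟₁.timeOrientation.vectorField q.1))
    rw [hmf]
    exact hφτ q.1 q.2
  · -- the `1`-jet of the extension `ψ` at the points of `S`
    rintro s ⟨y, rfl⟩
    refine ⟨W, ψ, hW, hχaW ⟨_, rfl⟩, hψs, hψU, ?_, ?_⟩
    · exact ((hjet y).1).symm
    · have hd : MDifferentiableAt (𝓡 4) (𝓡 4) φ' (ι₁ y) :=
        ((hφs _ (hι₁N' y)).contMDiffAt (N'.isOpen.mem_nhds (hι₁N' y))).mdifferentiableAt (by simp)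
      have hmf : mfderiv (𝓡 4) (𝓡 4) (fun q : N' ↦ φ' q.1) ⟨ι₁ y, hSN ⟨y, rfl⟩⟩ =
          mfderiv (𝓡 4) (𝓡 4) φ' (ι₁ y) :=
        mfderiv_comp_subtypeVal (y := (⟨ι₁ y, hSN ⟨y, rfl⟩⟩ : N')) hd
      rw [hmf]
      exact ((hjet y).2).symm
  · -- `p₀ ∈ N' \ U`
    intro hsub
    exact hp₀U (hsub (hp₀ ▸ hι₁N' y₀))

/-! ### Consequences: Thm. 12 and the item, from LU and the local boundary data -/

/-- **Sbierski's Theorem 12 from local uniqueness and the local boundary data.** Under LU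
(`hawkingEllis_locallyUnique_vacuumDevelopment`) and the boundary data (H1)–(H4) at a boundary
point of every common development with corresponding boundary points (hypothesis `hbd`: the
content of Sbierski's Lemmas 14–16 and of the time-separation argument of the proof of Thm. 12,
arXiv:1309.7591v3, pp. 13–16, displayed here and proved separately), every such common development
is strictly contained in a larger one
(`sbierski_commonDevelopment_lt_of_hasCorrespondingBoundaryPoints`): `restart_of_locallyUnique`
supplies the hypothesis `hrestart` of `sbierski_commonDevelopment_lt_of_restart_jet`. CONDITIONAL
on LU and on `hbd`. [cite: Sbierski2016AHP, §3.2, Thm. 12 and Lemmas 14–16 (arXiv numbering)] -/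
theorem thm12_of_locallyUnique_of_boundaryData (hLU : hawkingEllis_locallyUnique_vacuumDevelopment)
    (hbd : ∀ (N : Type) [TopologicalSpace N] [ChartedSpace E3 N] [IsManifold (𝓡 3) ∞ N]
      [ConnectedSpace N] (D₁ : InitialDataSet (𝓡 3) N) (𝒟₁ 𝒟₂ : VacuumCauchyDevelopment D₁)
      (𝔠 : CauchyDevelopment.CommonDevelopment 𝒟₁.toCauchyDevelopment 𝒟₂.toCauchyDevelopment),
      𝔠.HasCorrespondingBoundaryPoints →
        ∃ (p₀ : 𝒟₁.carrier) (W : Set 𝒟₁.carrier) (f : 𝒟₁.carrier → ℝ)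
          (ψ : 𝒟₁.carrier → 𝒟₂.carrier),
          p₀ ∉ 𝔠.opens ∧
          (p₀ ∈ 𝒟₁.metric.chronologicalFuture 𝒟₁.timeOrientation (range 𝒟₁.embed) ∨
            p₀ ∈ 𝒟₁.metric.chronologicalPast 𝒟₁.timeOrientation (range 𝒟₁.embed)) ∧
          IsOpen W ∧ p₀ ∈ W ∧ ContMDiffOn (𝓡 4) 𝓘(ℝ, ℝ) ∞ f W ∧ f p₀ = 0 ∧
          (∀ v : TangentSpace (𝓡 4) p₀, 𝒟₁.timeOrientation.IsFutureDirected v →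
            (0 : ℝ) < mfderiv (𝓡 4) 𝓘(ℝ, ℝ) f p₀ v) ∧
          (∀ q ∈ W, f q = 0 → q ∈ closure (𝔠.opens : Set 𝒟₁.carrier)) ∧
          ContMDiffOn (𝓡 4) (𝓡 4) ∞ ψ W ∧
          (∀ (q : 𝒟₁.carrier) (hq : q ∈ 𝔠.opens), q ∈ W → ψ q = 𝔠.map ⟨q, hq⟩) ∧
          Injective (mfderiv (𝓡 4) (𝓡 4) ψ p₀)) :
    sbierski_commonDevelopment_lt_of_hasCorrespondingBoundaryPoints := by
  refine sbierski_commonDevelopment_lt_of_restart_jet ?_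
  intro N _ _ _ _ D₁ 𝒟₁ 𝒟₂ 𝔠 h𝔠
  obtain ⟨p₀, W, f, ψ, hp₀U, hp₀I, hW, hp₀W, hf, hfp₀, hdf, hlevel, hψs, hψU, hdψ⟩ :=
    hbd N D₁ 𝒟₁ 𝒟₂ 𝔠 h𝔠
  exact restart_of_locallyUnique hLU 𝒟₁ 𝒟₂ 𝔠 hp₀U hp₀I hW hp₀W hf hfp₀ hdf hlevel hψs hψU hdψ

/-- **The item from local uniqueness and the local boundary data**: `SubdataDevelopmentsEmbed`
follows from LU and the boundary data `hbd` of `thm12_of_locallyUnique_of_boundaryData` (by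
`subdataDevelopmentsEmbed_of_locallyUnique_of_sbierski`). CONDITIONAL on both.
[cite: Sbierski2016AHP, Thm. 2.4 (ii), §3.2 Thm. 12] -/
theorem subdataDevelopmentsEmbed_of_locallyUnique_of_boundaryData
    (hLU : hawkingEllis_locallyUnique_vacuumDevelopment)
    (hbd : ∀ (N : Type) [TopologicalSpace N] [ChartedSpace E3 N] [IsManifold (𝓡 3) ∞ N]
      [ConnectedSpace N] (D₁ : InitialDataSet (𝓡 3) N) (𝒟₁ 𝒟₂ : VacuumCauchyDevelopment D₁)
      (𝔠 : CauchyDevelopment.CommonDevelopment 𝒟₁.toCauchyDevelopment 𝒟₂.toCauchyDevelopment),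
      𝔠.HasCorrespondingBoundaryPoints →
        ∃ (p₀ : 𝒟₁.carrier) (W : Set 𝒟₁.carrier) (f : 𝒟₁.carrier → ℝ)
          (ψ : 𝒟₁.carrier → 𝒟₂.carrier),
          p₀ ∉ 𝔠.opens ∧
          (p₀ ∈ 𝒟₁.metric.chronologicalFuture 𝒟₁.timeOrientation (range 𝒟₁.embed) ∨
            p₀ ∈ 𝒟₁.metric.chronologicalPast 𝒟₁.timeOrientation (range 𝒟₁.embed)) ∧
          IsOpen W ∧ p₀ ∈ W ∧ ContMDiffOn (𝓡 4) 𝓘(ℝ, ℝ) ∞ f W ∧ f p₀ = 0 ∧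
          (∀ v : TangentSpace (𝓡 4) p₀, 𝒟₁.timeOrientation.IsFutureDirected v →
            (0 : ℝ) < mfderiv (𝓡 4) 𝓘(ℝ, ℝ) f p₀ v) ∧
          (∀ q ∈ W, f q = 0 → q ∈ closure (𝔠.opens : Set 𝒟₁.carrier)) ∧
          ContMDiffOn (𝓡 4) (𝓡 4) ∞ ψ W ∧
          (∀ (q : 𝒟₁.carrier) (hq : q ∈ 𝔠.opens), q ∈ W → ψ q = 𝔠.map ⟨q, hq⟩) ∧
          Injective (mfderiv (𝓡 4) (𝓡 4) ψ p₀)) :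
    Summit.FinalStateConjecture.FinalStateConjecture.Theses.SwallowTheDatum.SubdataDevelopmentsEmbed :=
  subdataDevelopmentsEmbed_of_locallyUnique_of_sbierski hLU
    (thm12_of_locallyUnique_of_boundaryData hLU hbd)

end SubdataDevelopmentsEmbed

end Summit.FinalStateConjecture.FinalStateConjecture.Theorems

end
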